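import Summits.QuantumFields.YangMills.Theorems.ColdStartUniversalityLatticeLangevinDynkinForward
import Mathlib.MeasureTheory.Integral.IntervalIntegral.FundThmCalculus
import HarnessLib

/-!
# Route `ColdStartUniversality`, crux K_A1 `UniformColdStartMixing` (stmt-QuantumFields-24809), rung `stub_fixedCutoffMixing`:
# G-block, brick G2b — the time-dependent Dynkin formula for separable test functions

Helper file (seat `ym-line-csu-p1`, g7).  Calculus lemma (`sum_mul_eq_add_integral_of_forward`): if `Φ_k(τ) = c_k + ∫₀^τ γ_k`
with continuous `γ_k` and `a_k ∈ C¹`, then `Σ_k a_k(t) Φ_k(t) = Σ_k a_k(0) c_k + ∫₀ᵗ Σ_k (a_k' Φ_k + a_k γ_k)`.  With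
`dynkin_forward` this gives the **time-dependent Dynkin formula** for `u(s, y) = Σ_k a_k(s) f_k(y)` along the SU(2) SZZ dynamics
(`dynkin_separable`): `E u(t, X_t) = u(0, x) + ∫₀ᵗ E[(∂_s u + 𝓛u)(r, X_r)] dr` — the vehicle of the ground-state
supersolution ((D) wall) and Dyson-series ((Inv) wall) arguments.
No definition, no sorry.  RECORD-rung R3 plumbing; nothing here bears on the mass gap.
-/

set_option autoImplicit false

noncomputable section

namespace Summit.QuantumFields.YangMills.Theorems.ColdStartUniversality

open MeasureTheory ProbabilityTheory Finset Filter Topology intervalIntegral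
open scoped NNReal
open Literature.Probability.Process Literature.MathematicalPhysics.QuantumFieldTheory
open Literature.MathematicalPhysics.QuantumLattice (fundamentalRep fundamentalLatticeRep continuous_fundamentalRep)

/-- **Product rule in integrated form for finitely many forward equations**: if `Φ_k(τ) = c_k + ∫₀^τ γ_k` (`τ ≥ 0`) with
continuous `γ_k`, and `a_k` has a continuous derivative `a_k'`, then
`Σ_k a_k(t) Φ_k(t) = Σ_k a_k(0) c_k + ∫₀ᵗ Σ_k (a_k'(r) Φ_k(r) + a_k(r) γ_k(r)) dr` for `t ≥ 0`. [folklore] -/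
theorem sum_mul_eq_add_integral_of_forward {J : Type*} [Fintype J] {Φ γ a a' : J → ℝ → ℝ} {c : J → ℝ}
    (hΦ : ∀ k τ, 0 ≤ τ → Φ k τ = c k + ∫ r in (0 : ℝ)..τ, γ k r) (hγc : ∀ k, Continuous (γ k))
    (ha : ∀ k r, HasDerivAt (a k) (a' k r) r) (ha'c : ∀ k, Continuous (a' k)) {t : ℝ} (ht : 0 ≤ t) :
    ∑ k, a k t * Φ k t = ∑ k, a k 0 * c k + ∫ r in (0 : ℝ)..t, ∑ k, (a' k r * Φ k r + a k r * γ k r) := by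
  have hac : ∀ k, Continuous (a k) := fun k => continuous_iff_continuousAt.2 fun r => (ha k r).continuousAt
  have hprim : ∀ k, Continuous fun u => c k + ∫ r in (0 : ℝ)..u, γ k r := fun k =>
    continuous_const.add (intervalIntegral.continuous_primitive (fun a b => (hγc k).intervalIntegrable a b) 0)
  have hΦcont : ∀ k, ContinuousOn (Φ k) (Set.Ici 0) := fun k =>
    ((hprim k).continuousOn).congr fun u hu => hΦ k u hu
  have hΦderiv : ∀ k, ∀ r, 0 < r → HasDerivAt (Φ k) (γ k r) r := by
    intro k r hr
    have h1 : HasDerivAt (fun u => c k + ∫ v in (0 : ℝ)..u, γ k v) (γ k r) r := by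
      have h := intervalIntegral.integral_hasDerivAt_right ((hγc k).intervalIntegrable 0 r)
        ((hγc k).stronglyMeasurableAtFilter volume (𝓝 r)) (hγc k).continuousAt
      simpa using h.const_add (c k)
    refine h1.congr_of_eventuallyEq ?_
    filter_upwards [Ioi_mem_nhds hr] with u hu
    exact hΦ k u (le_of_lt hu)
  set H : ℝ → ℝ := fun r => ∑ k, a k r * Φ k r with hH
  have hHcont : ContinuousOn H (Set.Icc 0 t) := by
    refine continuousOn_finsetSum _ fun k _ => ((hac k).continuousOn).mul ((hΦcont k).mono fun r hr => hr.1)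
  have hHderiv : ∀ r ∈ Set.Ioo 0 t, HasDerivAt H (∑ k, (a' k r * Φ k r + a k r * γ k r)) r := by
    intro r hr
    have h := HasDerivAt.fun_sum (u := (univ : Finset J)) fun k _ => (ha k r).mul (hΦderiv k r hr.1)
    exact h
  have hH'cont : ContinuousOn (fun r => ∑ k, (a' k r * Φ k r + a k r * γ k r)) (Set.Icc 0 t) := by
    refine continuousOn_finsetSum _ fun k _ => ?_
    exact (((ha'c k).continuousOn).mul ((hΦcont k).mono fun r hr => hr.1)).add
      (((hac k).continuousOn).mul (hγc k).continuousOn)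
  have hFTC := intervalIntegral.integral_eq_sub_of_hasDerivAt_of_le ht hHcont hHderiv
    (hH'cont.intervalIntegrable_of_Icc ht)
  have hH0 : H 0 = ∑ k, a k 0 * c k := by
    simp only [hH]
    exact Finset.sum_congr rfl fun k _ => by rw [hΦ k 0 le_rfl, intervalIntegral.integral_same, add_zero]
  have hHt : H t = ∑ k, a k t * Φ k t := rfl
  rw [← hHt, ← hH0, hFTC]
  ring

variable {L : ℕ} [NeZero L]

/-- **Time-dependent Dynkin formula for separable test functions** along the SU(2) SZZ dynamics: for
`u(s, y) = Σ_k a_k(s) f_k(y)` with `a_k ∈ C¹` and `f_k ∈ C_c³`,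
`E u(t, X_t) = u(0, x) + ∫₀ᵗ E[Σ_k (a_k'(r) f_k(X_r) + a_k(r) (𝓛f_k)(X_r))] dr`. [folklore] -/
theorem dynkin_separable (β : ℝ) {Ω : Type} [MeasurableSpace Ω] {P : Measure Ω}
    [IsProbabilityMeasure P] {W : ℝ≥0 → Ω → (Edge 3 L × NoiseIdx 2 → ℝ)} (hW : IsFlatBrownian W P)
    (U : GaugeConfig 3 L (Matrix.specialUnitaryGroup (Fin 2) ℂ) → ℝ≥0 → Ω →
      GaugeConfig 3 L (Matrix.specialUnitaryGroup (Fin 2) ℂ))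
    (hU : ∀ x, (∀ ω, U x 0 ω = x) ∧
      (latticeLangevinDynamics (fundamentalLatticeRep 2) β).IsSolution (fundamentalRep (Fin 2))
        hW.natFiltration P W (U x))
    (hUm : ∀ i : ℝ≥0, Measurable[@Prod.instMeasurableSpace (Set.Iic i)
        (GaugeConfig 3 L (Matrix.specialUnitaryGroup (Fin 2) ℂ) × Ω) inferInstance
        (@Prod.instMeasurableSpace (GaugeConfig 3 L (Matrix.specialUnitaryGroup (Fin 2) ℂ)) Ω inferInstance
          (hW.natFiltration i))]
      (fun q : Set.Iic i × (GaugeConfig 3 L (Matrix.specialUnitaryGroup (Fin 2) ℂ) × Ω) => U q.2.1 q.1 q.2.2))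
    (x : GaugeConfig 3 L (Matrix.specialUnitaryGroup (Fin 2) ℂ))
    {J : Type*} [Fintype J] {f : J → (Edge 3 L × Fin 2 × Fin 2 × Bool → ℝ) → ℝ} (hf : ∀ k, ContDiff ℝ 3 (f k))
    (hfc : ∀ k, HasCompactSupport (f k)) {a a' : J → ℝ → ℝ} (ha : ∀ k r, HasDerivAt (a k) (a' k r) r)
    (ha'c : ∀ k, Continuous (a' k)) {t : ℝ} (ht : 0 ≤ t) :
    let coords : GaugeConfig 3 L (Matrix.specialUnitaryGroup (Fin 2) ℂ) → (Edge 3 L × Fin 2 × Fin 2 × Bool → ℝ) :=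
      fun V q => (fun z : ℂ => if q.2.2.2 then z.im else z.re)
        ((fundamentalRep (Fin 2) (V q.1) : Matrix (Fin 2) (Fin 2) ℂ) q.2.1 q.2.2.1)
    let gen : J → GaugeConfig 3 L (Matrix.specialUnitaryGroup (Fin 2) ℂ) → ℝ := fun k V =>
      (∑ i : Edge 3 L × Fin 2 × Fin 2 × Bool, fderiv ℝ (f k) (coords V) (Pi.single i 1) *
          (fun z : ℂ => if i.2.2.2 then z.im else z.re)
            ((latticeLangevinDynamics (fundamentalLatticeRep 2) β).drift
              (matrixConfig (fundamentalRep (Fin 2)) V) i.1 i.2.1 i.2.2.1) +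
      1 / 2 * ∑ i : Edge 3 L × Fin 2 × Fin 2 × Bool, ∑ j : Edge 3 L × Fin 2 × Fin 2 × Bool,
        fderiv ℝ (fun z => fderiv ℝ (f k) z (Pi.single i 1)) (coords V) (Pi.single j 1) *
          ∑ n : Edge 3 L × NoiseIdx 2,
            (if n.1 = i.1 then (fun z : ℂ => if i.2.2.2 then z.im else z.re)
              ((latticeLangevinDynamics (fundamentalLatticeRep 2) β).noise
                (matrixConfig (fundamentalRep (Fin 2)) V) i.1 n.2 i.2.1 i.2.2.1) else 0) *
            (if n.1 = j.1 then (fun z : ℂ => if j.2.2.2 then z.im else z.re)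
              ((latticeLangevinDynamics (fundamentalLatticeRep 2) β).noise
                (matrixConfig (fundamentalRep (Fin 2)) V) j.1 n.2 j.2.1 j.2.2.1) else 0))
    ∫ ω, ∑ k, a k t * f k (coords (U x t.toNNReal ω)) ∂P =
      ∑ k, a k 0 * f k (coords x) +
        ∫ r in (0 : ℝ)..t, ∫ ω, ∑ k, (a' k r * f k (coords (U x r.toNNReal ω)) + a k r * gen k (U x r.toNNReal ω)) ∂P := by
  intro coords gen
  classical
  haveI := secondCountableTopology_su2
  haveI := borelSpace_config L
  -- the forward equations, observable by observable
  have hfw := fun k => dynkin_forward (L := L) β hW U hU hUm x (hf k) (hfc k)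
  -- integrability of the observables along the flow
  have hco : Continuous coords := continuous_coords (L := L)
  have hObs_cont : ∀ k, Continuous fun V => f k (coords V) := fun k => (hf k).continuous.comp hco
  have hgen_cont : ∀ k, Continuous (gen k) := fun k => continuous_generator (L := L) β ((hf k).of_le (by norm_num))
  have hmeasU : ∀ r : ℝ≥0, Measurable (U x r) := fun r => ((hU x).2.adapted r).mono (hW.natFiltration.le r) le_rfl
  have hint_f : ∀ k (r : ℝ≥0), Integrable (fun ω => f k (coords (U x r ω))) P := by
    intro k r
    obtain ⟨M, -, hM⟩ := exists_abs_le_of_continuous (hObs_cont k)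
    exact Integrable.of_bound ((hObs_cont k).measurable.comp (hmeasU r)).aestronglyMeasurable M
      (Eventually.of_forall fun ω => by rw [Real.norm_eq_abs]; exact hM _)
  have hint_g : ∀ k (r : ℝ≥0), Integrable (fun ω => gen k (U x r ω)) P := by
    intro k r
    obtain ⟨M, -, hM⟩ := exists_abs_le_of_continuous (hgen_cont k)
    exact Integrable.of_bound ((hgen_cont k).measurable.comp (hmeasU r)).aestronglyMeasurable M
      (Eventually.of_forall fun ω => by rw [Real.norm_eq_abs]; exact hM _)
  -- the calculus lemma
  have hcalc := sum_mul_eq_add_integral_of_forward (J := J)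
    (Φ := fun k r => ∫ ω, f k (coords (U x r.toNNReal ω)) ∂P) (γ := fun k r => ∫ ω, gen k (U x r.toNNReal ω) ∂P)
    (a := a) (a' := a') (c := fun k => f k (coords x)) (fun k τ hτ => (hfw k).2.2 τ hτ) (fun k => (hfw k).2.1) ha ha'c ht
  -- push the finite sums inside the expectations
  have hLHS : ∫ ω, ∑ k, a k t * f k (coords (U x t.toNNReal ω)) ∂P =
      ∑ k, a k t * ∫ ω, f k (coords (U x t.toNNReal ω)) ∂P := by
    rw [integral_finsetSum _ fun k _ => (hint_f k _).const_mul _]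
    exact Finset.sum_congr rfl fun k _ => MeasureTheory.integral_const_mul _ _
  have hRHS : ∀ r : ℝ, ∫ ω, ∑ k, (a' k r * f k (coords (U x r.toNNReal ω)) + a k r * gen k (U x r.toNNReal ω)) ∂P =
      ∑ k, (a' k r * ∫ ω, f k (coords (U x r.toNNReal ω)) ∂P + a k r * ∫ ω, gen k (U x r.toNNReal ω) ∂P) := by
    intro r
    rw [integral_finsetSum _ fun k _ => ?_]
    · refine Finset.sum_congr rfl fun k _ => ?_
      rw [integral_add ((hint_f k _).const_mul _) ((hint_g k _).const_mul _), MeasureTheory.integral_const_mul,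
        MeasureTheory.integral_const_mul]
    · exact ((hint_f k _).const_mul _).add ((hint_g k _).const_mul _)
  rw [hLHS, hcalc]
  congr 1
  exact intervalIntegral.integral_congr fun r _ => (hRHS r).symm

end Summit.QuantumFields.YangMills.Theorems.ColdStartUniversality

end
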